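import Summits.QuantumFields.BalabanUV.T4Continuum.Support.NE3CoarseFrameData
import Summits.QuantumFields.BalabanUV.T4Continuum.Support.NE3BlockMeanExactLocal
import HarnessLib

/-!
# T⁴ programme, node NE3 — row E-MLw-(w4)-P-curved, row K5 (K5b-3b): THE COVARIANT BLOCK-MEAN-EXACT INTERPOLANT `IW` — definition,
# EXACT corner values and transported block means, 𝔲(n)-valuedness, and the IN-BLOCK covariant-gradient bound (faces: K5b-3c)

NE3 (node U1b) formalisation swarm, leaf seat `b2b-balaban-t4-ne3-formalise-leaf-01` (gen 5); row **K5** of ruling ρ-g22-2 (S7 competitor,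
holder leaf-01-g5), design `HOME/b2b-balaban-t4-ne3-formalise-leaf-01/g5/K5b-DESIGN.md`.  Assembles K5a (`bmeInterp`), K5b-1 (`dressW`), K5b-2
(`frameData`), K5b-3a (one-block energy) BY NAME.

THE OBJECT.  `IW M W U m x := Ad (btree M W (cdiv M x) x)⁻¹ (bmeInterp M (frameData U m (cdiv M x)) x)`: on the block of `x`, the flat
block-mean-exact interpolant of the datum READ IN THE CORNER'S FRAME (coarse transport `U` along tree words), dressed back to `x` along the fine
tree word (r1's convention).  CONTENT ([folklore]; 0 sorry; DATA defs `IW`, `vertexMass`):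
§1 `IW_eq_dressW` (on block `z`, `IW = dressW M W (bmeInterp M (frameData U m z))`), **`IW_corner`** (`IW (M•z) = m z`, `M ≥ 1`, `d ≥ 1`),
   **`bmeanW_IW`** (`bmeanW M W (IW M W U m) z = m z` EXACTLY, `M ≥ 2` — the competitor matches corner values AND transported block means),
   `bmeInterp_mem`, **`IW_mem_skewAdjoint`**;
§2 VALUES: `normSq_bmeInterp_le_local` (`‖bmeInterp M G y‖² ≤ 2·Σ_T ‖G (blk y + indic T)‖² + 2·d·256^d·cubeEnergy G (blk y)`);
§3 **`norm_gaugeDir_IW_inblock_le`** — for a bond with both ends in block `z` (small-field `W`, plaquette size `a`):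
   `‖gaugeDir W (IW M W U m) x μ‖ ≤ ‖dPot (bmeInterp M (frameData U m z)) x μ‖ + 2·(d−1)·(M−1)·a·‖bmeInterp M (frameData U m z) x‖`, whose two
   terms are summed over the block by K5b-3a `sum_block_normSq_dPot_bmeInterp_le` (against `cubeEnergy (frameData U m z) z`, itself ≤ covariant
   differences `D_U m` + `a_U`-defects by K5b-2 `norm_dPot_frameData_cube_le`) and by §2 (against `Σ_T ‖m (z + indic T)‖²`, `norm_frameData`).
   FACE bonds (the two neighbouring blocks' frames differ by `U(z,μ)` vs the fine straight line), periodicity, and the summed END: K5b-3c, after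
   the owner fixes the coarse background `U` of record (spec points of journal ≈17:10Z∕17:12Z).

HONEST FRAMING.  Kinematics at ONE background in the small-field class; nothing about Bałaban's minimisers; (P♮)∕(ML_w) at W ≠ 1, T-E_w and
**NE3 are NOT proved**; spine PROVED 0∕9; finite T⁴ rung (B)+1 — NOT infinite volume, NOT mass gap, NOT `BetaPertH`, NOT Clay.  PLACEMENT:
`Summits/QuantumFields/BalabanUV/`.  HONEST DEPENDENCY (cell page 1): continuum YM on T⁴ ⇐ BetaPertH ∧ nine spine estimates (0/9 proved);
BetaPertH ⇐ (D1) ∧ (D4) ∧ CAP+tail; G-an2-4 gates asym, D1 and NE2/3/4.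
-/

set_option autoImplicit false

open scoped BigOperators Matrix.Norms.L2Operator
open Finset

namespace Summit.QuantumFields.BalabanUV.T4Continuum.NE3CovariantInterpolantCore

open Literature.MathematicalPhysics.QuantumFieldTheory.Balaban1983to89
open B7Prop1Explicit B7Prop2Explicit
open T4AveragingDeficitWall (IsUnitaryCfg IsSkewDir SmallField Ad)
open T4AveragingDeficitWallBoundary (periodBox mem_periodBox card_periodBox IsPeriodicCfg)
open AveragingDeficitTransport (Ad_mem_skewAdjoint norm_Ad_of_unitary)
open AveragingDeficitBlockDensity (btree btree_mem)
open BlockAveragePushDirGauge (gaugeDir)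
open SkeletonLattice (cdiv cmod)
open SmoothRefineBlocks (blk)
open SmoothRefineInterp (indic interp interp_mem)
open NE3TangentNoGoWords (dPot)
open NE3CoarseInterpolant (normSq_interp_le blk_block)
open NE3TentBump (tent tentSum tentSum_pos tent_nonneg tent_le_one bump)
open NE3BlockMeanExactInterpolant (bmeCoef bmeInterp bmeInterp_corner sum_block_bmeInterp)
open NE3BlockMeanExactLocal (cubeEnergy cubeEnergy_nonneg normSq_bmeCoef_le_local)
open NE3CovariantBlockMean (bmeanW cdiv_cmod_block)
open NE3DressedBlockField (dressW dressW_corner cdiv_corner gaugeDir_dressW_inblock norm_gaugeDir_dressW_inblock_le cdiv_block)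
open NE3CoarseFrameData (frameData frameData_self frameData_mem_skewAdjoint norm_frameData)
open NE3GaugeDirFrames (Ad_Ad_inv)
open NE3BlockLineAverage (sum_univ_boxVec)

noncomputable section

variable {d : ℕ} {n : Type*} [Fintype n] [DecidableEq n]

/-! ## §1 The covariant interpolant: definition and exact properties -/

/-- **THE COVARIANT BLOCK-MEAN-EXACT INTERPOLANT** of a coarse datum `m` at the fine background `W` and coarse background `U`. [folklore] -/
def IW (M : ℕ) (W : Site d → Fin d → (Matrix n n ℂ)ˣ) (U : Site d → Fin d → (Matrix n n ℂ)ˣ) (m : Site d → Matrix n n ℂ)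
    (x : Site d) : Matrix n n ℂ :=
  Ad (btree M W (cdiv M x) x)⁻¹ (bmeInterp M (frameData U m (cdiv M x)) x)

/-- On the block `z`, `IW` is the dressed flat interpolant of the frame-`z` datum. [folklore] -/
theorem IW_eq_dressW (M : ℕ) (W U : Site d → Fin d → (Matrix n n ℂ)ˣ) (m : Site d → Matrix n n ℂ) {z x : Site d} (hx : cdiv M x = z) :
    IW M W U m x = dressW M W (bmeInterp M (frameData U m z)) x := by
  unfold IW dressW; rw [hx]

/-- **CORNER VALUES**: `IW M W U m (M•z) = m z` (`M ≥ 1`, `d ≥ 1`). [folklore] -/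
theorem IW_corner {M : ℕ} (hM : 1 ≤ M) (hd : 0 < d) (W U : Site d → Fin d → (Matrix n n ℂ)ˣ) (m : Site d → Matrix n n ℂ) (z : Site d) :
    IW M W U m ((M : ℤ) • z) = m z := by
  rw [IW_eq_dressW M W U m (cdiv_corner hM z), dressW_corner hM, bmeInterp_corner hM hd, frameData_self]

/-- `bmeanW` reads a site field only on the block. [folklore] -/
theorem bmeanW_congr (M : ℕ) (W : Site d → Fin d → (Matrix n n ℂ)ˣ) {μ μ' : Site d → Matrix n n ℂ} {z : Site d}
    (h : ∀ r : Fin d → Fin M, μ ((M : ℤ) • z + boxVec M r) = μ' ((M : ℤ) • z + boxVec M r)) : bmeanW M W μ z = bmeanW M W μ' z := by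
  unfold bmeanW
  exact Finset.sum_congr rfl fun r _ => by rw [h r]

/-- **EXACT TRANSPORTED BLOCK MEANS**: `bmeanW M W (IW M W U m) z = m z` (`M ≥ 2`). [folklore] -/
theorem bmeanW_IW {M : ℕ} (hM : 2 ≤ M) (W U : Site d → Fin d → (Matrix n n ℂ)ˣ) (m : Site d → Matrix n n ℂ) (z : Site d) :
    bmeanW M W (IW M W U m) z = m z := by
  have hM0 : ((M : ℝ) ^ d) ≠ 0 := by
    have : (0 : ℝ) < M := by exact_mod_cast (by omega : 0 < M)
    positivity
  have hblock : ∀ r : Fin d → Fin M, IW M W U m ((M : ℤ) • z + boxVec M r)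
      = dressW M W (bmeInterp M (frameData U m z)) ((M : ℤ) • z + boxVec M r) :=
    fun r => IW_eq_dressW M W U m (cdiv_cmod_block M z r).1
  rw [bmeanW_congr M W hblock, NE3DressedBlockField.bmeanW_dressW, sum_block_bmeInterp hM, smul_smul, inv_mul_cancel₀ hM0, one_smul,
    frameData_self]

/-- MEMBERSHIP of the block-mean-exact interpolant in a real-stable additive subgroup (e.g. 𝔲(n)). [folklore] -/
theorem bmeInterp_mem {𝔸 : Type*} [NormedRing 𝔸] [NormedSpace ℝ 𝔸] (K : AddSubgroup 𝔸) (hK : ∀ (r : ℝ) (x : 𝔸), x ∈ K → r • x ∈ K)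
    (M : ℕ) {G : Site d → 𝔸} (hG : ∀ w, G w ∈ K) (y : Site d) : bmeInterp M G y ∈ K := by
  unfold bmeInterp bump bmeCoef
  refine K.add_mem (interp_mem K hK M _ hG y) (hK _ _ (hK _ _ (K.sum_mem fun v _ => K.sub_mem (hG _) (interp_mem K hK M _ hG _))))

/-- **`IW` IS 𝔲(n)-VALUED** for 𝔲(n)-valued data at unitary backgrounds. [folklore] -/
theorem IW_mem_skewAdjoint (M : ℕ) {W U : Site d → Fin d → (Matrix n n ℂ)ˣ} (hWu : IsUnitaryCfg W) (hU : IsUnitaryCfg U)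
    {m : Site d → Matrix n n ℂ} (hm : ∀ w, m w ∈ skewAdjoint (Matrix n n ℂ)) (x : Site d) : IW M W U m x ∈ skewAdjoint (Matrix n n ℂ) := by
  unfold IW
  refine Ad_mem_skewAdjoint ((unitaryUnits _).inv_mem (btree_mem hWu M _ x)) ?_
  exact bmeInterp_mem (skewAdjoint (Matrix n n ℂ)) (fun r X hX => skewAdjoint.smul_mem r hX) M
    (fun w => frameData_mem_skewAdjoint hU hm _ w) x

/-! ## §2 The size of the interpolant's values -/

/-- **VALUES OF THE BLOCK-MEAN-EXACT INTERPOLANT**: `‖bmeInterp M G y‖² ≤ 2·Σ_{T⊆univ} ‖G (blk M y + indic T)‖² + 2·d·256^d·cubeEnergy G (blk M y)`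
(`M ≥ 2`; local convexity for the interpolant, `tent ≤ 1` and the local mean-correction bound for the bump). [folklore] -/
theorem normSq_bmeInterp_le_local {𝔸 : Type*} [NormedRing 𝔸] [NormedSpace ℝ 𝔸] {M : ℕ} (hM : 2 ≤ M) (G : Site d → 𝔸) (y : Site d) :
    ‖bmeInterp M G y‖ ^ 2 ≤ 2 * ∑ T ∈ (Finset.univ : Finset (Fin d)).powerset, ‖G (blk M y + indic T)‖ ^ 2
      + 2 * ((d : ℝ) * (256 : ℝ) ^ d * cubeEnergy G (blk M y)) := by
  have hM1 : 1 ≤ M := by omega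
  have hI := normSq_interp_le hM1 Finset.univ G y
  have hB : ‖bump M (bmeCoef M G) y‖ ^ 2 ≤ (d : ℝ) * (256 : ℝ) ^ d * cubeEnergy G (blk M y) := by
    unfold bump
    rw [norm_smul, Real.norm_of_nonneg (tent_nonneg hM1 y)]
    calc (tent M y * ‖bmeCoef M G (blk M y)‖) ^ 2 ≤ (1 * ‖bmeCoef M G (blk M y)‖) ^ 2 := by
          gcongr
          · exact mul_nonneg (tent_nonneg hM1 y) (norm_nonneg _)
          · exact tent_le_one hM1 y
      _ = ‖bmeCoef M G (blk M y)‖ ^ 2 := by ring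
      _ ≤ _ := normSq_bmeCoef_le_local hM G (blk M y)
  unfold bmeInterp
  have h := norm_add_le (interp M Finset.univ G y) (bump M (bmeCoef M G) y)
  nlinarith [sq_nonneg (‖interp M Finset.univ G y‖ - ‖bump M (bmeCoef M G) y‖), norm_nonneg (interp M Finset.univ G y),
    norm_nonneg (bump M (bmeCoef M G) y), norm_nonneg (interp M Finset.univ G y + bump M (bmeCoef M G) y)]

/-! ## §3 In-block bonds: the covariant gradient of `IW` -/

/-- **THE IN-BLOCK COVARIANT GRADIENT OF THE COVARIANT INTERPOLANT** (`W` unitary with `SmallField W a`, `0 ≤ a`, `M ≥ 1`; both ends of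
the bond in the block `z = cdiv M x`):
`‖gaugeDir W (IW M W U m) x μ‖ ≤ ‖dPot (bmeInterp M (frameData U m z)) x μ‖ + 2·((d−1)(M−1)·a)·‖bmeInterp M (frameData U m z) x‖`
— the flat coboundary of the frame-`z` interpolant (K5b-3a sums it against `cubeEnergy`) plus the comb-loop defect on the value (§2 sizes it).
[cite: Balaban1985Averaging, pp.24–25] -/
theorem norm_gaugeDir_IW_inblock_le [Nonempty n] {M : ℕ} (hM : 1 ≤ M) {W : Site d → Fin d → (Matrix n n ℂ)ˣ} (hWu : IsUnitaryCfg W)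
    {a : ℝ} (ha : 0 ≤ a) (hWa : SmallField W a) (U : Site d → Fin d → (Matrix n n ℂ)ˣ) (m : Site d → Matrix n n ℂ)
    {z x : Site d} {μ : Fin d} (hx : cdiv M x = z) (hx' : cdiv M (x + e μ) = z) :
    ‖gaugeDir W (IW M W U m) x μ‖
      ≤ ‖dPot (bmeInterp M (frameData U m z)) x μ‖
        + 2 * (((d : ℝ) - 1) * ((M : ℝ) - 1) * a) * ‖bmeInterp M (frameData U m z) x‖ := by
  -- on the bond both values of `IW` are values of the dressed frame-`z` interpolant
  have hg : gaugeDir W (IW M W U m) x μ = gaugeDir W (dressW M W (bmeInterp M (frameData U m z))) x μ := by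
    simp only [gaugeDir, IW_eq_dressW M W U m hx, IW_eq_dressW M W U m hx']
  rw [hg]
  exact norm_gaugeDir_dressW_inblock_le hM hWu ha hWa _ (by rw [hx, hx'])

end

end Summit.QuantumFields.BalabanUV.T4Continuum.NE3CovariantInterpolantCore
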